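import Summits.QuantumFields.YangMills.Theorems.AlphaInputsT3ACv3NewtonLiftFlat
import Summits.QuantumFields.YangMills.Theorems.AlphaInputsT3ACv3RelativeGauge
import HarnessLib

/-!
# `AlphaInputsT3ACv3GaugeInterp` — (r1-σ), the ANALYTIC letter (σ-A): **ONE-PARAMETER INTERPOLATION OF A NEAR-IDENTITY GAUGE TRANSFORMATION**, `t_λ := exp(λ·mlog t)`, and the BOND LEDGER OF
# THE GLUED GAUGE `σ := t_λ·σ₂` (`t = σ₁σ₂⁻¹`): on every bond `‖U^{σ}(b) − 1‖ ≤ η₂ + 6ρ·|λ(b₋) − λ(b₊)| + 4(η₁ + η₂)` — the `O(ρ) = O(Bε)` relative rotation between two `η`-flat gauges is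
# spread over the width of the ramp `λ`, so nothing switches sharply (L-3-safe); `σ = σ₁` where `λ = 1`, `σ = σ₂` where `λ = 0` — cell `ym3-torus`, width seat `ym-ust-19936-w2` (g2), for
# ★w1-19936 g2 LEAD's row (r1-σ) (frames `ψ(b,c) := Ad(σ_c(b₋)⁻¹σ_c(ĉ₋))` from ANY fine gauge `σ_c` that is `η′`-flat on `(stencil of c) ∩ Ω_fine`)

WHY (w1 g2 02:22:38Z (r1-route)∕(r1-σ); w1 g2 LOCATED L-3).  A fine gauge flattening `U` on a face-connected union of cells is built by gluing box axial gauges; two flattening gauges of the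
same field differ by a relative rotation `t` that is `O(ρ)` from `1` on the overlap but moves only by `η₁ + η₂` per bond (★w4 `RelativeGauge.norm_relGauge_tgt_sub_src_le`).  Switching
from `σ₁` to `σ₂` SHARPLY costs `O(ρ)` on the switching bonds; switching through `t_λ·σ₂` with a scalar ramp `λ` costs `6ρ·|Δλ| + 4(η₁+η₂)` per bond — with `|Δλ| ≤ 1/w` across a
collar of width `w = L^k` this is the `O(Bε·L^{−k})` the (r1) frames need.  Every factor stays in `SU(n)` (`mlog t ∈ 𝔰𝔲(n)` for `‖t − 1‖ ≤ 1/4`, `|n|·‖t − 1‖ < π`).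
WHAT.  §1 matrix letters: `norm_mul_star_sub_one_eq` (`‖A·B* − 1‖ = ‖A − B‖`, `B` unitary), `norm_conj_sub_le` (`‖T W T′* − 1‖ ≤ ‖W − 1‖ + ‖T − T′‖`), `norm_mlog_sub_mlog_le` (`≤ (4/3)‖A − B‖` on
`‖· − 1‖ ≤ 1/4`), ★ `norm_exp_smul_mlog_sub_le` (`‖exp(λ·mlog T) − exp(λ′·mlog T′)‖ ≤ 6ρ|λ − λ′| + 4‖T − T′‖` for `‖T − 1‖, ‖T′ − 1‖ ≤ ρ ≤ 1/4`, `λ, λ′ ∈ [0,1]`); §2 `interpSU t λ ∈ SU(n)`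
(a `dite` on the log window; `coe_interpSU`, `interpSU_one`, `interpSU_zero`), `interpGauge g₁ g₂ lam : GaugeTransf` (`= g₁` where `lam = 1` on the window, `= g₂` where `lam = 0`); §3 ★★
`norm_gaugeAct_interpGauge_sub_one_le` (the displayed bond ledger).
HONEST FRAMING.  Matrix bookkeeping; count-neutral helper toward the (FL) row of 2′∕2′χ (`--supports stmt-QuantumFields-19936`); (FL)∕`hLift`, the stub, the crux and the gap are NOT claimed;
registry untouched.  YM₃ on the three-torus is RUNG R3 of the programme, not the Clay problem.

References: T. Bałaban, Commun. Math. Phys. 98 (1985) 17–51 [Balaban1985Averaging] ((19)–(23) p.21, (8) p.18); Commun. Math. Phys. 99 (1985) 75–102 [Balaban1985RegularSpaces] (Lemma 1 (1.25) p.79).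
-/

set_option autoImplicit false

noncomputable section

open scoped Matrix.Norms.L2Operator
open NormedSpace

namespace Summit.QuantumFields.YangMills.Theorems.GaugeInterp

open Literature.MathematicalPhysics.QuantumFieldTheory.Balaban1983to89
open Literature.MathematicalPhysics.QuantumFieldTheory.Balaban1983to89.MatrixLog (mlog mlog_one exp_mlog norm_mlog_le_two_mul)
open Literature.MathematicalPhysics.QuantumFieldTheory.Balaban1983to89.T4AdjointCovarianceUnitary (lieSU mem_lieSU_iff exp_mem_specialUnitaryGroup_of_mem_lieSU)
open Literature.MathematicalPhysics.QuantumFieldTheory.Balaban1983to89.FederbushMean (norm_mlog_sub_mlog_sub_le)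
open Summit.QuantumFields.YangMills.Theorems.NewtonLiftFlat (norm_exp_sub_exp_sub_sub_le mlog_defect_mem_lieSU)
open Summit.QuantumFields.YangMills.Theorems.RelativeGauge (norm_relGauge_tgt_sub_src_le)

variable {n : Type*} [Fintype n] [DecidableEq n] [Nonempty n]

/-! ## §1 Matrix letters -/

omit [Nonempty n] in
/-- `‖A·B* − 1‖ = ‖A − B‖` for `B` unitary (`A B* − 1 = (A − B)B*`). [cite: Balaban1985Averaging, (19) p.21] -/
theorem norm_mul_star_sub_one_eq (A : Matrix n n ℂ) (B : Matrix.specialUnitaryGroup n ℂ) :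
    ‖A * star (B : Matrix n n ℂ) - 1‖ = ‖A - (B : Matrix n n ℂ)‖ := by
  have hB : (B : Matrix n n ℂ) * star (B : Matrix n n ℂ) = 1 := Unitary.mul_star_self_of_mem B.2.1
  have e : A * star (B : Matrix n n ℂ) - 1 = (A - (B : Matrix n n ℂ)) * star (B : Matrix n n ℂ) := by rw [sub_mul, hB]
  rw [e, CStarRing.norm_mul_mem_unitary _ (Unitary.star_mem B.2.1)]

omit [Nonempty n] in
/-- `‖T·W·T′* − 1‖ ≤ ‖W − 1‖ + ‖T − T′‖` for `T, T′, W` in `SU(n)` (insert `T T′*`). [cite: Balaban1985Averaging, (19) p.21] -/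
theorem norm_conj_sub_le (T W T' : Matrix.specialUnitaryGroup n ℂ) :
    ‖(T : Matrix n n ℂ) * (W : Matrix n n ℂ) * star (T' : Matrix n n ℂ) - 1‖ ≤ ‖(W : Matrix n n ℂ) - 1‖ + ‖(T : Matrix n n ℂ) - (T' : Matrix n n ℂ)‖ := by
  have e : (T : Matrix n n ℂ) * (W : Matrix n n ℂ) * star (T' : Matrix n n ℂ) - 1 =
      (T : Matrix n n ℂ) * ((W : Matrix n n ℂ) - 1) * star (T' : Matrix n n ℂ) + ((T : Matrix n n ℂ) * star (T' : Matrix n n ℂ) - 1) := by noncomm_ring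
  rw [e]
  refine (norm_add_le _ _).trans (add_le_add ?_ (le_of_eq (norm_mul_star_sub_one_eq _ _)))
  rw [CStarRing.norm_mul_mem_unitary _ (Unitary.star_mem T'.2.1), CStarRing.norm_mem_unitary_mul _ T.2.1]

omit [Nonempty n] in
/-- The series logarithm is `4/3`-Lipschitz on `‖· − 1‖ ≤ 1/4` (`FederbushMean.norm_mlog_sub_mlog_sub_le` with `ρ = 1/4`). [folklore] -/
theorem norm_mlog_sub_mlog_le {A B : Matrix n n ℂ} (hA : ‖A - 1‖ ≤ 1 / 4) (hB : ‖B - 1‖ ≤ 1 / 4) : ‖mlog A - mlog B‖ ≤ 4 / 3 * ‖A - B‖ := by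
  have h := norm_mlog_sub_mlog_sub_le (𝔸 := Matrix n n ℂ) (ρ := 1 / 4) (by norm_num) hA hB
  have e : mlog A - mlog B = (mlog A - mlog B - (A - B)) + (A - B) := by abel
  rw [e]
  calc ‖mlog A - mlog B - (A - B) + (A - B)‖ ≤ ‖mlog A - mlog B - (A - B)‖ + ‖A - B‖ := norm_add_le _ _
    _ ≤ (1 / 4) / (1 - 1 / 4) * ‖A - B‖ + ‖A - B‖ := add_le_add h le_rfl
    _ = 4 / 3 * ‖A - B‖ := by ring

/-- **★ THE INTERPOLATED ROTATIONS ARE LIPSCHITZ IN `(λ, T)`**: `‖exp(λ·mlog T) − exp(λ′·mlog T′)‖ ≤ 6ρ·|λ − λ′| + 4‖T − T′‖` for `‖T − 1‖, ‖T′ − 1‖ ≤ ρ ≤ 1/4` and `λ, λ′ ∈ [0,1]`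
(`‖mlog T‖ ≤ 2ρ ≤ 1/2`, `e^{1/2} ≤ 3`, the logarithm `4/3`-Lipschitz). [folklore] -/
theorem norm_exp_smul_mlog_sub_le {T T' : Matrix n n ℂ} {ρ lam lam' : ℝ} (hT : ‖T - 1‖ ≤ ρ) (hT' : ‖T' - 1‖ ≤ ρ) (hρ : ρ ≤ 1 / 4)
    (hl0 : 0 ≤ lam) (hl1 : lam ≤ 1) (hl0' : 0 ≤ lam') (hl1' : lam' ≤ 1) :
    ‖exp (lam • mlog T) - exp (lam' • mlog T')‖ ≤ 6 * ρ * |lam - lam'| + 4 * ‖T - T'‖ := by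
  have hρ0 : 0 ≤ ρ := (norm_nonneg _).trans hT
  have hX : ‖mlog T‖ ≤ 2 * ρ := (norm_mlog_le_two_mul (hT.trans (by linarith))).trans (by linarith)
  have hX' : ‖mlog T'‖ ≤ 2 * ρ := (norm_mlog_le_two_mul (hT'.trans (by linarith))).trans (by linarith)
  have hXX' : ‖mlog T - mlog T'‖ ≤ 4 / 3 * ‖T - T'‖ := norm_mlog_sub_mlog_le (hT.trans hρ) (hT'.trans hρ)
  set x : Matrix n n ℂ := lam • mlog T with hx
  set y : Matrix n n ℂ := lam' • mlog T' with hy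
  have hxn : ‖x‖ ≤ 1 / 2 := by
    rw [hx, norm_smul, Real.norm_eq_abs, abs_of_nonneg hl0]; nlinarith [norm_nonneg (mlog T)]
  have hyn : ‖y‖ ≤ 1 / 2 := by
    rw [hy, norm_smul, Real.norm_eq_abs, abs_of_nonneg hl0']; nlinarith [norm_nonneg (mlog T')]
  -- `‖x − y‖ ≤ |λ − λ′|·2ρ + λ′·(4/3)‖T − T′‖`
  have hdiff : ‖x - y‖ ≤ |lam - lam'| * (2 * ρ) + 4 / 3 * ‖T - T'‖ := by
    have e : x - y = (lam - lam') • mlog T + lam' • (mlog T - mlog T') := by rw [hx, hy, sub_smul, smul_sub]; abel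
    rw [e]
    calc ‖(lam - lam') • mlog T + lam' • (mlog T - mlog T')‖ ≤ ‖(lam - lam') • mlog T‖ + ‖lam' • (mlog T - mlog T')‖ := norm_add_le _ _
      _ = |lam - lam'| * ‖mlog T‖ + |lam'| * ‖mlog T - mlog T'‖ := by rw [norm_smul, norm_smul, Real.norm_eq_abs, Real.norm_eq_abs]
      _ ≤ |lam - lam'| * (2 * ρ) + 1 * (4 / 3 * ‖T - T'‖) := by
          refine add_le_add (mul_le_mul_of_nonneg_left hX (abs_nonneg _)) (mul_le_mul ?_ hXX' (norm_nonneg _) zero_le_one)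
          rw [abs_of_nonneg hl0']; exact hl1'
      _ = |lam - lam'| * (2 * ρ) + 4 / 3 * ‖T - T'‖ := by ring
  -- `‖e^x − e^y‖ ≤ ‖x − y‖·e^{1/2} ≤ 3‖x − y‖`
  have hexp := norm_exp_sub_exp_sub_sub_le (𝔄 := Matrix n n ℂ) x y
  have hmax : max ‖x‖ ‖y‖ ≤ 1 / 2 := max_le hxn hyn
  have hE : Real.exp (max ‖x‖ ‖y‖) ≤ 3 := by
    refine (Real.exp_le_exp.mpr (hmax.trans (by norm_num : (1:ℝ)/2 ≤ 1))).trans ?_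
    have := Real.exp_one_lt_d9; linarith
  have hd0 : 0 ≤ ‖x - y‖ := norm_nonneg _
  have e2 : exp x - exp y = (exp x - exp y - (x - y)) + (x - y) := by abel
  rw [e2]
  calc ‖exp x - exp y - (x - y) + (x - y)‖ ≤ ‖exp x - exp y - (x - y)‖ + ‖x - y‖ := norm_add_le _ _
    _ ≤ ‖x - y‖ * (Real.exp (max ‖x‖ ‖y‖) - 1) + ‖x - y‖ := add_le_add hexp le_rfl
    _ ≤ ‖x - y‖ * (3 - 1) + ‖x - y‖ := by gcongr
    _ = 3 * ‖x - y‖ := by ring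
    _ ≤ 3 * (|lam - lam'| * (2 * ρ) + 4 / 3 * ‖T - T'‖) := by gcongr
    _ = 6 * ρ * |lam - lam'| + 4 * ‖T - T'‖ := by ring

/-! ## §2 The interpolated rotation as an `SU(n)` element; the interpolated gauge -/

omit [Nonempty n] in
/-- `mlog t ∈ 𝔰𝔲(n)` on the log window `‖t − 1‖ ≤ 1/4`, `|n|·‖t − 1‖ < π` (skew by `star_mlog_eq_neg`, traceless by `trace_mlog_eq_zero`; = ★w4's `mlog_defect_mem_lieSU` at `V = 1`).
[cite: Balaban1985Averaging, (22)–(23) p.21] -/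
theorem mlog_mem_lieSU (t : Matrix.specialUnitaryGroup n ℂ) (h4 : ‖(t : Matrix n n ℂ) - 1‖ ≤ 1 / 4) (hπ : (Fintype.card n : ℝ) * ‖(t : Matrix n n ℂ) - 1‖ < Real.pi) :
    mlog (t : Matrix n n ℂ) ∈ lieSU n := by
  have h := mlog_defect_mem_lieSU t 1 (ρ := ‖(t : Matrix n n ℂ) - 1‖) (by simp) h4 hπ
  simpa using h

/-- **THE INTERPOLATED ROTATION** `t_λ := exp(λ·mlog t) ∈ SU(n)` (on the log window; `1` off it — a harmless `dite`). [cite: Balaban1985Averaging, (22)–(23) p.21] -/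
def interpSU (t : Matrix.specialUnitaryGroup n ℂ) (lam : ℝ) : Matrix.specialUnitaryGroup n ℂ :=
  if h : ‖(t : Matrix n n ℂ) - 1‖ ≤ 1 / 4 ∧ (Fintype.card n : ℝ) * ‖(t : Matrix n n ℂ) - 1‖ < Real.pi then
    ⟨exp (lam • mlog (t : Matrix n n ℂ)), exp_mem_specialUnitaryGroup_of_mem_lieSU ((lieSU n).smul_mem lam (mlog_mem_lieSU t h.1 h.2))⟩
  else 1

omit [Nonempty n] in
/-- On the window, `t_λ = exp(λ·mlog t)` as a matrix. [cite: Balaban1985Averaging, (22)–(23) p.21] -/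
theorem coe_interpSU (t : Matrix.specialUnitaryGroup n ℂ) (lam : ℝ) (h4 : ‖(t : Matrix n n ℂ) - 1‖ ≤ 1 / 4) (hπ : (Fintype.card n : ℝ) * ‖(t : Matrix n n ℂ) - 1‖ < Real.pi) :
    ((interpSU t lam : Matrix.specialUnitaryGroup n ℂ) : Matrix n n ℂ) = exp (lam • mlog (t : Matrix n n ℂ)) := by
  unfold interpSU; rw [dif_pos ⟨h4, hπ⟩]

omit [Nonempty n] in
/-- `t_1 = t` (on the window: `exp ∘ mlog = id`). [cite: Balaban1985Averaging, (22)–(23) p.21] -/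
theorem interpSU_one (t : Matrix.specialUnitaryGroup n ℂ) (h4 : ‖(t : Matrix n n ℂ) - 1‖ ≤ 1 / 4) (hπ : (Fintype.card n : ℝ) * ‖(t : Matrix n n ℂ) - 1‖ < Real.pi) :
    interpSU t 1 = t := by
  apply Subtype.ext
  rw [coe_interpSU t 1 h4 hπ, one_smul, exp_mlog (h4.trans_lt (by norm_num))]

omit [Nonempty n] in
/-- `t_0 = 1` (always). [folklore] -/
theorem interpSU_zero (t : Matrix.specialUnitaryGroup n ℂ) : interpSU t 0 = 1 := by
  unfold interpSU
  split_ifs with h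
  · apply Subtype.ext
    simp [zero_smul, exp_zero]
  · rfl

variable {P : Params} {j : ℕ}

/-- **THE INTERPOLATED (GLUED) GAUGE** `σ := t_λ·g₂`, `t = g₁g₂⁻¹`, `λ : sites → [0,1]` the ramp. [cite: Balaban1985Averaging, (8) p.18] -/
def interpGauge (g₁ g₂ : GaugeTransf P j (Matrix.specialUnitaryGroup n ℂ)) (lam : Site P j → ℝ) : GaugeTransf P j (Matrix.specialUnitaryGroup n ℂ) :=
  fun x => interpSU (g₁ x * (g₂ x)⁻¹) (lam x) * g₂ x

omit [Nonempty n] in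
/-- Where the ramp is `1` (on the window) the glued gauge IS `g₁`. [cite: Balaban1985Averaging, (8) p.18] -/
theorem interpGauge_of_one (g₁ g₂ : GaugeTransf P j (Matrix.specialUnitaryGroup n ℂ)) (lam : Site P j → ℝ) (x : Site P j) (hx : lam x = 1)
    (h4 : ‖((g₁ x * (g₂ x)⁻¹ : Matrix.specialUnitaryGroup n ℂ) : Matrix n n ℂ) - 1‖ ≤ 1 / 4)
    (hπ : (Fintype.card n : ℝ) * ‖((g₁ x * (g₂ x)⁻¹ : Matrix.specialUnitaryGroup n ℂ) : Matrix n n ℂ) - 1‖ < Real.pi) :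
    interpGauge g₁ g₂ lam x = g₁ x := by
  unfold interpGauge; rw [hx, interpSU_one _ h4 hπ]; group

omit [Nonempty n] in
/-- Where the ramp is `0` the glued gauge IS `g₂`. [cite: Balaban1985Averaging, (8) p.18] -/
theorem interpGauge_of_zero (g₁ g₂ : GaugeTransf P j (Matrix.specialUnitaryGroup n ℂ)) (lam : Site P j → ℝ) (x : Site P j) (hx : lam x = 0) :
    interpGauge g₁ g₂ lam x = g₂ x := by
  unfold interpGauge; rw [hx, interpSU_zero, one_mul]

/-! ## §3 The bond ledger of the glued gauge -/

/-- **★★ THE GLUED GAUGE IS FLAT UP TO THE RAMP SLOPE**: with `g₁` `η₁`-flat and `g₂` `η₂`-flat at the bond `b`, the relative rotation `t = g₁g₂⁻¹` within `ρ ≤ 1/4` of `1` at both ends (and in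
the log window), and a ramp `λ` with values in `[0,1]`: `‖U^{σ}(b) − 1‖ ≤ η₂ + 6ρ·|λ(b₋) − λ(b₊)| + 4(η₁ + η₂)` for `σ = interpGauge g₁ g₂ λ` — the rotation `t = 1 + O(ρ)` is never switched on
a single bond, only ramped (`t` itself moves by `≤ η₁ + η₂` per bond: ★w4 `RelativeGauge.norm_relGauge_tgt_sub_src_le`). [cite: Balaban1985Averaging, (19)–(23) p.21; Balaban1985RegularSpaces, Lemma 1 (1.25) p.79] -/
theorem norm_gaugeAct_interpGauge_sub_one_le (U : GaugeField P j (Matrix.specialUnitaryGroup n ℂ)) (g₁ g₂ : GaugeTransf P j (Matrix.specialUnitaryGroup n ℂ))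
    (lam : Site P j → ℝ) (b : PBond P j) {η₁ η₂ ρ : ℝ}
    (h₁ : ‖((GaugeField.gaugeAct g₁ U b : Matrix.specialUnitaryGroup n ℂ) : Matrix n n ℂ) - 1‖ ≤ η₁)
    (h₂ : ‖((GaugeField.gaugeAct g₂ U b : Matrix.specialUnitaryGroup n ℂ) : Matrix n n ℂ) - 1‖ ≤ η₂)
    (hs : ‖((g₁ b.src * (g₂ b.src)⁻¹ : Matrix.specialUnitaryGroup n ℂ) : Matrix n n ℂ) - 1‖ ≤ ρ)
    (ht : ‖((g₁ b.tgt * (g₂ b.tgt)⁻¹ : Matrix.specialUnitaryGroup n ℂ) : Matrix n n ℂ) - 1‖ ≤ ρ) (hρ : ρ ≤ 1 / 4)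
    (hπs : (Fintype.card n : ℝ) * ‖((g₁ b.src * (g₂ b.src)⁻¹ : Matrix.specialUnitaryGroup n ℂ) : Matrix n n ℂ) - 1‖ < Real.pi)
    (hπt : (Fintype.card n : ℝ) * ‖((g₁ b.tgt * (g₂ b.tgt)⁻¹ : Matrix.specialUnitaryGroup n ℂ) : Matrix n n ℂ) - 1‖ < Real.pi)
    (hl0 : 0 ≤ lam b.src) (hl1 : lam b.src ≤ 1) (hl0' : 0 ≤ lam b.tgt) (hl1' : lam b.tgt ≤ 1) :
    ‖((GaugeField.gaugeAct (interpGauge g₁ g₂ lam) U b : Matrix.specialUnitaryGroup n ℂ) : Matrix n n ℂ) - 1‖ ≤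
      η₂ + 6 * ρ * |lam b.src - lam b.tgt| + 4 * (η₁ + η₂) := by
  set tm : Matrix.specialUnitaryGroup n ℂ := g₁ b.src * (g₂ b.src)⁻¹ with htm
  set tp : Matrix.specialUnitaryGroup n ℂ := g₁ b.tgt * (g₂ b.tgt)⁻¹ with htp
  set Tm : Matrix.specialUnitaryGroup n ℂ := interpSU tm (lam b.src) with hTm
  set Tp : Matrix.specialUnitaryGroup n ℂ := interpSU tp (lam b.tgt) with hTp
  set W₂ : Matrix.specialUnitaryGroup n ℂ := GaugeField.gaugeAct g₂ U b with hW₂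
  -- the glued bond variable is `Tm · W₂ · Tp⁻¹`
  have e : GaugeField.gaugeAct (interpGauge g₁ g₂ lam) U b = Tm * W₂ * Tp⁻¹ := by
    show interpSU (g₁ b.src * (g₂ b.src)⁻¹) (lam b.src) * g₂ b.src * U b * (interpSU (g₁ b.tgt * (g₂ b.tgt)⁻¹) (lam b.tgt) * g₂ b.tgt)⁻¹ =
      Tm * (g₂ b.src * U b * (g₂ b.tgt)⁻¹) * Tp⁻¹
    rw [← htm, ← htp, ← hTm, ← hTp]; group
  rw [e, Submonoid.coe_mul, Submonoid.coe_mul]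
  have hinv : ((Tp⁻¹ : Matrix.specialUnitaryGroup n ℂ) : Matrix n n ℂ) = star (Tp : Matrix n n ℂ) := rfl
  rw [hinv]
  refine (norm_conj_sub_le Tm W₂ Tp).trans ?_
  -- the two interpolated rotations differ by the ramp slope and the motion of `t`
  have hmove := norm_relGauge_tgt_sub_src_le g₁ g₂ U b
  rw [← htm, ← htp] at hmove
  have hTT : ‖(Tm : Matrix n n ℂ) - (Tp : Matrix n n ℂ)‖ ≤ 6 * ρ * |lam b.src - lam b.tgt| + 4 * ‖(tm : Matrix n n ℂ) - (tp : Matrix n n ℂ)‖ := by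
    rw [hTm, hTp, coe_interpSU tm _ (hs.trans hρ) hπs, coe_interpSU tp _ (ht.trans hρ) hπt]
    exact norm_exp_smul_mlog_sub_le hs ht hρ hl0 hl1 hl0' hl1'
  have ht_sub : ‖(tm : Matrix n n ℂ) - (tp : Matrix n n ℂ)‖ ≤ η₁ + η₂ := by
    rw [norm_sub_rev]; exact hmove.trans (add_le_add h₁ h₂)
  linarith [hTT, ht_sub, h₂]

end Summit.QuantumFields.YangMills.Theorems.GaugeInterp

end
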